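import Summits.AtomisticToContinuum.Crystallization.Theorems.SquareWellLayerCakeTwelveWithinOneReturn

/-!
# Crux `GappedShellCensus.RadialDefectsVanish` (stmt-AtomisticToContinuum-15930), line `palm-pinned-scale`:
# `stub_returnRadial` — from the measure-level radial predicate with slack to the crux's count

FROM MEASURE-LEVEL GAPPED-TWELVE WITH SLACK TO THE CRUX AT THE PINNED SCALE `a₀ = 50/51`.  If every
minimising point-stationary hard-core law on rooted configurations of `ℝ³` satisfies, almost surely,
[all atoms pairwise `(55/57 + σ)`-separated ∧ every atom `w ≠ 0` has `‖w‖ ≤ 1 − σ` or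
`‖w‖ ≥ 21/17 + σ` ∧ the atoms `w ≠ 0` of norm `≤ 1 − σ` are exactly twelve] (`σ > 0`), and
Lennard-Jones ground states have Benjamini–Schramm limits (density-transfer form) along every
prescribed subsequence, then for every sequence of ground states the fraction of particles that are
NOT gapped-twelve at scale `50/51` (twelve others within `50/51·(1 + 1/50) = 1`, none closer than
`50/51·(1 − 1/50) = 49/51`, none in the open annulus `(1, 50/51·63/50) = (1, 21/17)`) tends to `0`.

Proof = the landed `SquareWellLayerCakeTwelveWithinOne.stub_return` (portmanteau with slack along
subsequences, `false_of_counts`) with its matching lemma replaced by `radialGood_of_matched`: the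
particles within `1` of a matched particle inject into the twelve shell atoms (an atom within `1 + ε`
of the root is the root or a shell atom, by the gap; two particles on one atom are `2ε < δₓ` apart),
and the twelve shell atoms are hit by twelve distinct particles within `1 − σ + ε ≤ 1`; a particle
closer than `49/51` would sit on an atom of norm `< 55/57 + σ`, i.e. on the root; a particle at
distance in `(1, 21/17)` would sit on an atom of norm in `(1 − σ, 21/17 + σ)`, excluded.
-/

noncomputable section

open MeasureTheory Filter Set
open scoped ENNReal Topology

namespace Summit.AtomisticToContinuum.Crystallization.Theorems.RadialDefectsVanishPalmPinnedScale

open Literature.MathematicalPhysics.StatisticalMechanics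
open Summit.AtomisticToContinuum.Crystallization.Theorems.SquareWellLayerCakeTwelveWithinOne (false_of_counts)


/-- The three numerals of the crux's inline clause at the pinned scale `a₀ = 50/51`. [folklore] -/
theorem pinnedScale_numerals :
    (50 / 51 * (1 + 1 / 50) : ℝ) = 1 ∧ (50 / 51 * (1 - 1 / 50) : ℝ) = 49 / 51 ∧
      (50 / 51 * (63 / 50) : ℝ) = 21 / 17 := by
  norm_num

/-- **The matching claim (deterministic geometry).** Let `y` be a `δₓ`-separated configuration, `i`
an index, and `S ∋ 0` a set of atoms which is pairwise `(55/57 + σ)`-separated, radially gapped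
(every atom `w ≠ 0` has `‖w‖ ≤ 1 − σ` or `‖w‖ ≥ 21/17 + σ`) and whose atoms `w ≠ 0` of norm
`≤ 1 − σ` form a twelve-element finset `T`.  If the recentred configuration `k ↦ y k - y i` and `S`
are `ε`-matched within radius `3` with `2ε ≤ σ`, `2ε < δₓ`, then `i` is gapped-twelve at the pinned
scale: exactly twelve `j ≠ i` within distance `1`, all `j ≠ i` at distance `≥ 49/51`, and every
`j ≠ i` at distance `≤ 1` or `≥ 21/17`. [folklore] -/
theorem radialGood_of_matched {N : ℕ} (y : Fin N → (EuclideanSpace ℝ (Fin 3))) (i : Fin N)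
    {σ δₓ ε : ℝ} (hε : 0 < ε) (hεσ : 2 * ε ≤ σ) (hεδₓ : 2 * ε < δₓ)
    (hsepy : ∀ j k : Fin N, j ≠ k → δₓ ≤ dist (y j) (y k))
    (S : Set (EuclideanSpace ℝ (Fin 3))) (h0 : (0 : (EuclideanSpace ℝ (Fin 3))) ∈ S)
    (hsep : ∀ w ∈ S, ∀ w' ∈ S, w ≠ w' → 55 / 57 + σ ≤ dist w w')
    (hgap : ∀ w ∈ S, w ≠ 0 → (‖w‖ ≤ 1 - σ ∨ 21 / 17 + σ ≤ ‖w‖))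
    (T : Finset (EuclideanSpace ℝ (Fin 3))) (hT12 : T.card = 12) (hT : ∀ w ∈ T, w ∈ S ∧ w ≠ 0 ∧ ‖w‖ ≤ 1 - σ)
    (hTall : ∀ w ∈ S, w ≠ 0 → ‖w‖ ≤ 1 - σ → w ∈ T)
    (ha : ∀ p ∈ S, ‖p‖ ≤ 3 → ∃ k : Fin N, dist (y k - y i) p ≤ ε)
    (hb : ∀ k : Fin N, ‖y k - y i‖ ≤ 3 → ∃ p ∈ S, dist (y k - y i) p ≤ ε) :
    (Finset.univ.filter fun j : Fin N => j ≠ i ∧ dist (y i) (y j) ≤ 1).card = 12 ∧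
      ∀ j : Fin N, j ≠ i → (49 : ℝ) / 51 ≤ dist (y i) (y j) ∧
        (dist (y i) (y j) ≤ 1 ∨ (21 : ℝ) / 17 ≤ dist (y i) (y j)) := by
  classical
  -- an atom within `ε` of a recentred particle `j ≠ i` is not the root
  have hne0 : ∀ j : Fin N, j ≠ i → ∀ p : (EuclideanSpace ℝ (Fin 3)), dist (y j - y i) p ≤ ε → p ≠ 0 := by
    intro j hji p hp hp0
    rw [hp0, dist_zero_right, ← dist_eq_norm] at hp
    have := hsepy j i hji
    linarith
  -- a non-root atom has norm `≥ 55/57 + σ`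
  have hfar0 : ∀ p ∈ S, p ≠ 0 → 55 / 57 + σ ≤ ‖p‖ := by
    intro p hp hp0
    rw [← dist_zero_right]
    exact hsep p hp 0 h0 hp0
  refine ⟨le_antisymm ?_ ?_, ?_⟩
  · -- (≤ 12) the particles within `1` inject into `T`
    have hchoice : ∀ k : Fin N, ∃ p : (EuclideanSpace ℝ (Fin 3)), ‖y k - y i‖ ≤ 3 → p ∈ S ∧ dist (y k - y i) p ≤ ε := by
      intro k
      by_cases hk : ‖y k - y i‖ ≤ 3
      · obtain ⟨p, hpS, hp⟩ := hb k hk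
        exact ⟨p, fun _ => ⟨hpS, hp⟩⟩
      · exact ⟨0, fun h => absurd h hk⟩
    choose pf hpf using hchoice
    rw [← hT12]
    refine Finset.card_le_card_of_injOn pf ?_ ?_
    · intro j hj
      have hj' := Finset.mem_filter.1 (Finset.mem_coe.1 hj)
      obtain ⟨hji, hd⟩ := hj'.2
      have hn3 : ‖y j - y i‖ ≤ 3 := by rw [← dist_eq_norm, dist_comm]; linarith
      obtain ⟨hpS, hp⟩ := hpf j hn3
      have hp0 : pf j ≠ 0 := hne0 j hji (pf j) hp
      have hpn : ‖pf j‖ ≤ 1 + ε := by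
        have h := dist_triangle (pf j) (y j - y i) 0
        rw [dist_zero_right, dist_zero_right, dist_comm (pf j), ← dist_eq_norm, dist_comm (y j)] at h
        linarith
      have hp1 : ‖pf j‖ ≤ 1 - σ := by
        rcases hgap (pf j) hpS hp0 with h | h
        · exact h
        · exfalso
          have : (21 : ℝ) / 17 + σ ≤ 1 + ε := h.trans hpn
          linarith
      exact Finset.mem_coe.2 (hTall (pf j) hpS hp0 hp1)
    · intro j hj j' hj' hjj
      by_contra hne
      have hj1 := Finset.mem_filter.1 (Finset.mem_coe.1 hj)
      have hj2 := Finset.mem_filter.1 (Finset.mem_coe.1 hj')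
      have hn3 : ‖y j - y i‖ ≤ 3 := by rw [← dist_eq_norm, dist_comm]; linarith [hj1.2.2]
      have hn3' : ‖y j' - y i‖ ≤ 3 := by rw [← dist_eq_norm, dist_comm]; linarith [hj2.2.2]
      have hp := (hpf j hn3).2
      have hp' := (hpf j' hn3').2
      rw [hjj] at hp
      have h := dist_triangle (y j - y i) (pf j') (y j' - y i)
      rw [dist_sub_right, dist_comm (pf j') (y j' - y i)] at h
      have := hsepy j j' hne
      linarith
  · -- (≥ 12) the twelve shell atoms are hit by twelve distinct particles within `1`
    have hchoice : ∀ w : (EuclideanSpace ℝ (Fin 3)), ∃ k : Fin N, w ∈ T → dist (y k - y i) w ≤ ε := by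
      intro w
      by_cases hw : w ∈ T
      · obtain ⟨hwS, -, hw1⟩ := hT w hw
        obtain ⟨k, hk⟩ := ha w hwS (by linarith)
        exact ⟨k, fun _ => hk⟩
      · exact ⟨i, fun h => absurd h hw⟩
    choose kf hkf using hchoice
    rw [← hT12]
    refine Finset.card_le_card_of_injOn kf ?_ ?_
    · intro w hw
      have hwT : w ∈ T := Finset.mem_coe.1 hw
      obtain ⟨hwS, hw0, hw1⟩ := hT w hwT
      have hk := hkf w hwT
      refine Finset.mem_coe.2 (Finset.mem_filter.2 ⟨Finset.mem_univ _, ?_, ?_⟩)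
      · intro hki
        rw [hki, sub_self, dist_comm, dist_zero_right] at hk
        have h := hfar0 w hwS hw0
        have hσε : ε < 55 / 57 + σ := by linarith
        linarith
      · rw [dist_comm, dist_eq_norm]
        have h := dist_triangle (y (kf w) - y i) w 0
        rw [dist_zero_right, dist_zero_right] at h
        linarith
    · intro w hw w' hw' hkeq
      by_contra hne
      have h1 := hkf w (Finset.mem_coe.1 hw)
      have h2 := hkf w' (Finset.mem_coe.1 hw')
      rw [hkeq, dist_comm] at h1
      have h := hsep w (hT w (Finset.mem_coe.1 hw)).1 w' (hT w' (Finset.mem_coe.1 hw')).1 hne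
      linarith [dist_triangle w (y (kf w') - y i) w']
  · -- radial window and gap for every `j ≠ i`
    intro j hji
    by_cases h3 : ‖y j - y i‖ ≤ 3
    · obtain ⟨p, hpS, hp⟩ := hb j h3
      have hp0 : p ≠ 0 := hne0 j hji p hp
      have hpn := hfar0 p hpS hp0
      -- `|‖p‖ - dist (y i) (y j)| ≤ ε`
      have hup : ‖p‖ ≤ dist (y i) (y j) + ε := by
        have h := dist_triangle p (y j - y i) 0
        rw [dist_zero_right, dist_zero_right, dist_comm p, ← dist_eq_norm, dist_comm (y j)] at h
        linarith
      have hlo : dist (y i) (y j) ≤ ‖p‖ + ε := by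
        have h := dist_triangle (y j - y i) p 0
        rw [dist_zero_right, dist_zero_right, ← dist_eq_norm, dist_comm (y j)] at h
        linarith
      refine ⟨?_, ?_⟩
      · -- `49/51 < 55/57`, so a closer particle would sit on the root
        have h4951 : (49 : ℝ) / 51 + ε < 55 / 57 + σ := by
          have : (49 : ℝ) / 51 < 55 / 57 := by norm_num
          linarith
        linarith
      · by_contra hnot
        push Not at hnot
        obtain ⟨hgt1, hlt⟩ := hnot
        rcases hgap p hpS hp0 with h | h
        · linarith
        · linarith
    · -- far particles: distance `> 3 ≥ 21/17`
      rw [not_le, ← dist_eq_norm, dist_comm] at h3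
      refine ⟨by linarith, Or.inr (by linarith)⟩

/-- The matching claim for a configuration MEASURE `ν = count|S`, with the predicate and the two
matching clauses in the form delivered by the density transfer of the Benjamini–Schramm limit, and
the conclusion in the literal form of the crux's clause at `a := 50/51`. [folklore] -/
theorem radialGood_of_matched_measure {N : ℕ} (y : Fin N → (EuclideanSpace ℝ (Fin 3))) (i : Fin N)
    {σ δ δₓ ε : ℝ} (hε : 0 < ε) (hεσ : 2 * ε ≤ σ) (hεδₓ : 2 * ε < δₓ)
    (hsepy : ∀ j k : Fin N, j ≠ k → δₓ ≤ dist (y j) (y k))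
    (ν : Measure (EuclideanSpace ℝ (Fin 3)))
    (hgood : (∀ w w' : (EuclideanSpace ℝ (Fin 3)), ν {w} ≠ 0 → ν {w'} ≠ 0 → w ≠ w' → 55 / 57 + σ ≤ dist w w') ∧
      (∀ w : (EuclideanSpace ℝ (Fin 3)), ν {w} ≠ 0 → w ≠ 0 → (‖w‖ ≤ 1 - σ ∨ 21 / 17 + σ ≤ ‖w‖)) ∧
      ∃ T : Finset (EuclideanSpace ℝ (Fin 3)), T.card = 12 ∧ (∀ w ∈ T, ν {w} ≠ 0 ∧ w ≠ 0 ∧ ‖w‖ ≤ 1 - σ) ∧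
        ∀ w : (EuclideanSpace ℝ (Fin 3)), ν {w} ≠ 0 → w ≠ 0 → ‖w‖ ≤ 1 - σ → w ∈ T)
    (hcore : ∃ S : Set (EuclideanSpace ℝ (Fin 3)), (0 : (EuclideanSpace ℝ (Fin 3))) ∈ S ∧ (∀ x ∈ S, ∀ y ∈ S, x ≠ y → δ ≤ dist x y) ∧
      ν = (Measure.count : Measure (EuclideanSpace ℝ (Fin 3))).restrict S)
    (ha : ∀ p : (EuclideanSpace ℝ (Fin 3)), ν {p} ≠ 0 → ‖p‖ ≤ 3 → ∃ q ∈ (Set.range (fun k : Fin N => y k - y i)), dist q p ≤ ε)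
    (hb : ∀ q ∈ (Set.range (fun k : Fin N => y k - y i)), ‖q‖ ≤ 3 → ∃ p : (EuclideanSpace ℝ (Fin 3)), ν {p} ≠ 0 ∧ dist q p ≤ ε) :
    (Finset.univ.filter fun j : Fin N => j ≠ i ∧ dist (y i) (y j) ≤ 50 / 51 * (1 + 1 / 50)).card = 12 ∧
      ∀ j : Fin N, j ≠ i → 50 / 51 * (1 - 1 / 50) ≤ dist (y i) (y j) ∧
        (dist (y i) (y j) ≤ 50 / 51 * (1 + 1 / 50) ∨ 50 / 51 * (63 / 50) ≤ dist (y i) (y j)) := by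
  obtain ⟨e1, e2, e3⟩ := pinnedScale_numerals
  simp only [e1, e2, e3]
  obtain ⟨S, h0, -, rfl⟩ := hcore
  simp only [Literature.Probability.Process.count_restrict_singleton_ne_zero_iff] at hgood ha hb
  obtain ⟨hsep, hgap, T, hT12, hT, hTall⟩ := hgood
  refine radialGood_of_matched y i hε hεσ hεδₓ hsepy S h0
    (fun w hw w' hw' hne => hsep w w' hw hw' hne) hgap T hT12 hT hTall ?_ ?_
  · intro p hp hp3
    obtain ⟨q, ⟨k, rfl⟩, hq⟩ := ha p hp hp3
    exact ⟨k, hq⟩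
  · intro k hk
    exact hb (y k - y i) ⟨k, rfl⟩ hk

/-- **`stub_returnRadial` (line `palm-pinned-scale`, crux `GappedShellCensus.RadialDefectsVanish`)** —
FROM THE MEASURE-LEVEL RADIAL PREDICATE WITH SLACK TO THE CRUX'S COUNT AT THE PINNED SCALE `50/51`:
subsequence contradiction via `radialGood_of_matched_measure` with `R = 3`,
`ε = min σ δₓ / 3`, and the landed `false_of_counts`. [folklore] -/
theorem stub_returnRadial :
    ∀ σ : ℝ, 0 < σ →
    (∀ δ : ℝ, 0 < δ → ∀ P : Measure (Measure (EuclideanSpace ℝ (Fin 3))), IsProbabilityMeasure P →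
      (∀ᵐ μ ∂P, (∃ S : Set (EuclideanSpace ℝ (Fin 3)), (0 : (EuclideanSpace ℝ (Fin 3))) ∈ S ∧ (∀ x ∈ S, ∀ y ∈ S, x ≠ y → δ ≤ dist x y) ∧
        μ = (Measure.count : Measure (EuclideanSpace ℝ (Fin 3))).restrict S)) →
      (∀ g : Measure (EuclideanSpace ℝ (Fin 3)) → (EuclideanSpace ℝ (Fin 3)) → ℝ≥0∞, Measurable (Function.uncurry g) →
        ∫⁻ μ, ∫⁻ y, g μ y ∂μ ∂P = ∫⁻ μ, ∫⁻ y, g (Measure.map (fun z => z - y) μ) (-y) ∂μ ∂P) →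
      (∫ μ, (∫ y, lennardJones ‖y‖ ∂μ) / 2 ∂P) ≤
        (⨅ Q : PeriodicConfiguration 3, Q.energyPerParticle lennardJones) →
      ∀ᵐ μ ∂P,
        (∀ w w' : (EuclideanSpace ℝ (Fin 3)), μ {w} ≠ 0 → μ {w'} ≠ 0 → w ≠ w' → 55 / 57 + σ ≤ dist w w') ∧
          (∀ w : (EuclideanSpace ℝ (Fin 3)), μ {w} ≠ 0 → w ≠ 0 → (‖w‖ ≤ 1 - σ ∨ 21 / 17 + σ ≤ ‖w‖)) ∧
          ∃ T : Finset (EuclideanSpace ℝ (Fin 3)), T.card = 12 ∧ (∀ w ∈ T, μ {w} ≠ 0 ∧ w ≠ 0 ∧ ‖w‖ ≤ 1 - σ) ∧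
            ∀ w : (EuclideanSpace ℝ (Fin 3)), μ {w} ≠ 0 → w ≠ 0 → ‖w‖ ≤ 1 - σ → w ∈ T) →
    (∀ x : (N : ℕ) → (Fin N → (EuclideanSpace ℝ (Fin 3))), (∀ N, IsGroundState lennardJones (x N)) →
      ∀ ψ : ℕ → ℕ, StrictMono ψ →
      ∃ φ : ℕ → ℕ, StrictMono φ ∧ ∃ δ : ℝ, 0 < δ ∧
        ∃ P : Measure (Measure (EuclideanSpace ℝ (Fin 3))), IsProbabilityMeasure P ∧
        (∀ᵐ μ ∂P, (∃ S : Set (EuclideanSpace ℝ (Fin 3)), (0 : (EuclideanSpace ℝ (Fin 3))) ∈ S ∧ (∀ x ∈ S, ∀ y ∈ S, x ≠ y → δ ≤ dist x y) ∧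
          μ = (Measure.count : Measure (EuclideanSpace ℝ (Fin 3))).restrict S)) ∧
        (∀ g : Measure (EuclideanSpace ℝ (Fin 3)) → (EuclideanSpace ℝ (Fin 3)) → ℝ≥0∞, Measurable (Function.uncurry g) →
          ∫⁻ μ, ∫⁻ y, g μ y ∂μ ∂P = ∫⁻ μ, ∫⁻ y, g (Measure.map (fun z => z - y) μ) (-y) ∂μ ∂P) ∧
        Filter.Tendsto (fun j : ℕ => groundStateEnergy lennardJones 3 (ψ (φ j)) / (ψ (φ j) : ℝ))
          Filter.atTop (nhds (∫ μ, (∫ y, lennardJones ‖y‖ ∂μ) / 2 ∂P)) ∧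
        ∀ T : Set (Measure (EuclideanSpace ℝ (Fin 3))), ∀ R ε : ℝ, 0 < ε → ∀ ρ : ℝ, ρ < (P T).toReal →
          ∀ᶠ j : ℕ in Filter.atTop, ρ * (ψ (φ j) : ℝ) ≤ (Nat.card {i : Fin (ψ (φ j)) // ∃ ν ∈ T,
            ((∀ p : (EuclideanSpace ℝ (Fin 3)), ν {p} ≠ 0 → ‖p‖ ≤ R →
                ∃ q ∈ (Set.range (fun k : Fin (ψ (φ j)) => x (ψ (φ j)) k - x (ψ (φ j)) i)), dist q p ≤ ε) ∧
              (∀ q ∈ (Set.range (fun k : Fin (ψ (φ j)) => x (ψ (φ j)) k - x (ψ (φ j)) i)), ‖q‖ ≤ R →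
                ∃ p : (EuclideanSpace ℝ (Fin 3)), ν {p} ≠ 0 ∧ dist q p ≤ ε))} : ℝ)) →
    ∀ x : (N : ℕ) → (Fin N → (EuclideanSpace ℝ (Fin 3))), (∀ N, IsGroundState lennardJones (x N)) →
      Filter.Tendsto (fun N : ℕ => (Nat.card {i : Fin N //
        ¬ ((Finset.univ.filter fun j : Fin N =>
              j ≠ i ∧ dist (x N i) (x N j) ≤ 50 / 51 * (1 + 1 / 50)).card = 12 ∧
            ∀ j : Fin N, j ≠ i → 50 / 51 * (1 - 1 / 50) ≤ dist (x N i) (x N j) ∧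
              (dist (x N i) (x N j) ≤ 50 / 51 * (1 + 1 / 50) ∨
                50 / 51 * (63 / 50) ≤ dist (x N i) (x N j)))} : ℝ) / N)
        Filter.atTop (nhds 0) := by
  intro σ hσ hLaws hBS x hx
  obtain ⟨δₓ, hδₓ, hsepx⟩ := LennardJonesMinimalDistance_holds
  rw [Metric.tendsto_nhds]
  intro η hη
  by_contra hnot
  -- a subsequence `ψ` along which the bad fraction stays `≥ η`
  obtain ⟨ψ, hψ, hψbad⟩ := Filter.extraction_of_frequently_atTop (Filter.not_eventually.1 hnot)
  -- the Benjamini–Schramm limit along `ψ ∘ φ`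
  obtain ⟨φ, hφ, δ, hδ, P, hP, hcore, hstat, hE, htransfer⟩ := hBS x hx ψ hψ
  -- the limit law is minimising
  have hlim : Filter.Tendsto (fun N : ℕ => groundStateEnergy lennardJones 3 N / (N : ℝ))
      Filter.atTop (𝓝 (⨅ Q : PeriodicConfiguration 3, Q.energyPerParticle lennardJones)) :=
    Summit.AtomisticToContinuum.Crystallization.Theses.PalmUnimodularRigidity.CrysEnergyLimit_holds
  have hEq : (∫ μ, (∫ y, lennardJones ‖y‖ ∂μ) / 2 ∂P) =
      ⨅ Q : PeriodicConfiguration 3, Q.energyPerParticle lennardJones :=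
    tendsto_nhds_unique hE (hlim.comp (hψ.comp hφ).tendsto_atTop)
  have hgoodae := hLaws δ hδ P hP hcore hstat hEq.le
  -- the set of good rooted hard-core configurations has full measure
  set Tset : Set (Measure (EuclideanSpace ℝ (Fin 3))) := {ν |
      ((∀ w w' : (EuclideanSpace ℝ (Fin 3)), ν {w} ≠ 0 → ν {w'} ≠ 0 → w ≠ w' → 55 / 57 + σ ≤ dist w w') ∧
          (∀ w : (EuclideanSpace ℝ (Fin 3)), ν {w} ≠ 0 → w ≠ 0 → (‖w‖ ≤ 1 - σ ∨ 21 / 17 + σ ≤ ‖w‖)) ∧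
          ∃ T : Finset (EuclideanSpace ℝ (Fin 3)), T.card = 12 ∧ (∀ w ∈ T, ν {w} ≠ 0 ∧ w ≠ 0 ∧ ‖w‖ ≤ 1 - σ) ∧
            ∀ w : (EuclideanSpace ℝ (Fin 3)), ν {w} ≠ 0 → w ≠ 0 → ‖w‖ ≤ 1 - σ → w ∈ T) ∧
        ∃ S : Set (EuclideanSpace ℝ (Fin 3)), (0 : (EuclideanSpace ℝ (Fin 3))) ∈ S ∧ (∀ x ∈ S, ∀ y ∈ S, x ≠ y → δ ≤ dist x y) ∧
          ν = (Measure.count : Measure (EuclideanSpace ℝ (Fin 3))).restrict S} with hTset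
  have hTae : ∀ᵐ μ ∂P, μ ∈ Tset := hgoodae.and hcore
  have hTc : P Tsetᶜ = 0 := mem_ae_iff.1 hTae
  have hPT : (P Tset).toReal = 1 := by
    rw [measure_congr (ae_eq_univ.2 hTc), measure_univ, ENNReal.toReal_one]
  -- the matching tolerance
  have hmin : 0 < min σ δₓ := lt_min hσ hδₓ
  have hminσ : min σ δₓ ≤ σ := min_le_left _ _
  have hminδₓ : min σ δₓ ≤ δₓ := min_le_right _ _
  set ε : ℝ := min σ δₓ / 3 with hε_def
  have hε : 0 < ε := by positivity
  have hεσ : 2 * ε ≤ σ := by linarith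
  have hεδₓ : 2 * ε < δₓ := by linarith
  have hρ : 1 - η / 2 < (P Tset).toReal := by rw [hPT]; linarith
  -- a large index along `ψ ∘ φ` where `≥ (1 - η/2)·N` particles are matched
  obtain ⟨j, hj, hj1⟩ := ((htransfer Tset 3 ε hε (1 - η / 2) hρ).and
    ((hψ.comp hφ).tendsto_atTop.eventually (eventually_ge_atTop 1))).exists
  refine false_of_counts hη _ _ hj (hψbad (φ j)) hj1 ?_
  rintro i ⟨ν, hνT, ha, hb⟩
  obtain ⟨hg, hc⟩ := hνT
  exact radialGood_of_matched_measure (x (ψ (φ j))) i hε hεσ hεδₓ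
    (fun a b hab => hsepx _ _ (hx _) a b hab) ν hg hc ha hb

end Summit.AtomisticToContinuum.Crystallization.Theorems.RadialDefectsVanishPalmPinnedScale

end
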